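import Mathlib
import Literature.AlgebraicGeometry.Resolution.LocalBlowup
import Literature.AlgebraicGeometry.Resolution.TranscendenceDefect
import Literature.RingTheory.KrullDimension.AffineDimension
import Literature.RingTheory.KrullDimension.LocalizationDimension
import Literature.FieldTheory.Separability.PDegreeSeparablyGenerated
import Summits.ResolutionOfSingularities.ResolutionOfSingularities.Theorems.RadicialJungCleanModelsLens5GradedBasis
import Summits.ResolutionOfSingularities.ResolutionOfSingularities.Theorems.RadicialJungCleanModelsLens5ImmediateValuesDegree
import Summits.ResolutionOfSingularities.ResolutionOfSingularities.Theorems.RadicialJungCleanModelsLens5ImmediateValuesMain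
import Summits.ResolutionOfSingularities.ResolutionOfSingularities.Theorems.RadicialJungCleanModelsLens5PRankTwoCurrency
import HarnessLib

/-!
# PORT (T-slice module map §16 (vii), part 1) of res-B-lens-5's `Cruxes/DescentPerfectToAll/Lens5_PRankTwoAssembly.lean` rev 7 (bef6ad8d44ee):
# PORT 1 `port_gradedData` (graded data of THEOREM T: the twist field `M = K^p(g₀)` with `p`-th-power values, `(P2)` normalised, generators of
# `A` graded over the valuation `p`-basis) with its helpers, and the §2 kernel helpers

Author res-B-lens-5 (g10); ported verbatim (namespace/import surgery only; the currency `PRankTwoAt` is ✓ `…Lens5.PRankTwoCurrency` by porter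
res-B-cdiv-w4) by the line lead res-B-lead-1 g5 for crux stmt-15917, stub `stub_cleanLU3DefectNonDiscrete` (T-slice).  OURS; nothing here proves
resolution in characteristic `p`.
-/

noncomputable section

set_option linter.dupNamespace false -- mandated namespace of this single-conjunct summit

open IsLocalRing
open Literature.AlgebraicGeometry.Resolution
open Summit.ResolutionOfSingularities.ResolutionOfSingularities.Theorems.RadicialJung.CleanModels.Lens5.GradedBasis
open Summit.ResolutionOfSingularities.ResolutionOfSingularities.Theorems.RadicialJung.CleanModels.Lens5.ImmediateValues
open Summit.ResolutionOfSingularities.ResolutionOfSingularities.Theorems.RadicialJung.CleanModels.Lens5.PRankTwoCurrency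

namespace Summit.ResolutionOfSingularities.ResolutionOfSingularities.Theorems.RadicialJung.CleanModels.Lens5.PRankTwoAssembly

section PortOne

open AlgebraicGeometry CategoryTheory

/-! ### (rev 3) helpers for PORT 1 — (P2) bookkeeping and the p-degree (copied census lemmas carry their proofs) -/

/-- (P2) is symmetric under inverting `x` (census ✓ `pRankTwo_inv_left`, verbatim with proof). [folklore] -/
theorem pRankTwo_inv_left {K : Type} [Field K] {p : ℕ} (O : ValuationSubring K) {x y : K} (hx : x ≠ 0)
    (hP : ∀ a b : ℕ, a < p → b < p → (a ≠ 0 ∨ b ≠ 0) → ∀ z : K, z ≠ 0 → O.valuation (x ^ a * y ^ b) ≠ O.valuation (z ^ p)) :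
    ∀ a b : ℕ, a < p → b < p → (a ≠ 0 ∨ b ≠ 0) → ∀ z : K, z ≠ 0 →
      O.valuation (x⁻¹ ^ a * y ^ b) ≠ O.valuation (z ^ p) := by
  intro a b ha hb hab z hz h
  rcases Nat.eq_zero_or_pos a with rfl | hapos
  · simp only [pow_zero, one_mul] at h
    exact hP 0 b ha hb hab z hz (by simpa using h)
  · have hpa : p - a < p := Nat.sub_lt (lt_of_le_of_lt (Nat.zero_le a) ha) hapos
    have hpa0 : p - a ≠ 0 := Nat.sub_ne_zero_of_lt ha
    apply hP (p - a) b hpa hb (Or.inl hpa0) (x * z) (mul_ne_zero hx hz)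
    have hxp : x ^ (p - a) = x ^ p * x⁻¹ ^ a := by
      rw [inv_pow, ← div_eq_mul_inv, eq_div_iff (pow_ne_zero a hx), ← pow_add, Nat.sub_add_cancel (le_of_lt ha)]
    rw [hxp, mul_assoc, map_mul, h, ← map_mul, ← mul_pow]

/-- (P2) is symmetric in `x`, `y`. [folklore] -/
theorem pRankTwo_swap {K : Type} [Field K] {p : ℕ} (O : ValuationSubring K) {x y : K}
    (hP : ∀ a b : ℕ, a < p → b < p → (a ≠ 0 ∨ b ≠ 0) → ∀ z : K, z ≠ 0 → O.valuation (x ^ a * y ^ b) ≠ O.valuation (z ^ p)) :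
    ∀ a b : ℕ, a < p → b < p → (a ≠ 0 ∨ b ≠ 0) → ∀ z : K, z ≠ 0 →
      O.valuation (y ^ a * x ^ b) ≠ O.valuation (z ^ p) := by
  intro a b ha hb hab z hz
  rw [mul_comm]
  exact hP b a hb ha hab.symm z hz

/-- Under (P2), `v x ≠ 1` (take `(a, b) = (1, 0)`, `z = 1`). [folklore] -/
theorem valuation_ne_one_of_pRankTwo {K : Type} [Field K] {p : ℕ} (hp : p.Prime) (O : ValuationSubring K) {x y : K}
    (hP : ∀ a b : ℕ, a < p → b < p → (a ≠ 0 ∨ b ≠ 0) → ∀ z : K, z ≠ 0 → O.valuation (x ^ a * y ^ b) ≠ O.valuation (z ^ p)) :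
    O.valuation x ≠ 1 := by
  intro h1
  exact hP 1 0 hp.one_lt hp.pos (Or.inl one_ne_zero) 1 one_ne_zero
    (by rw [pow_one, pow_zero, mul_one, one_pow, map_one, h1])

/-- (P2) normalised: replacing `x` by `x` or `x⁻¹` one may assume `v x < 1` (i.e. `x ∈ 𝔪_O`). [folklore] -/
theorem exists_pRankTwo_lt_one_left {K : Type} [Field K] {p : ℕ} (hp : p.Prime) (O : ValuationSubring K) {x y : K}
    (hx : x ≠ 0)
    (hP : ∀ a b : ℕ, a < p → b < p → (a ≠ 0 ∨ b ≠ 0) → ∀ z : K, z ≠ 0 → O.valuation (x ^ a * y ^ b) ≠ O.valuation (z ^ p)) :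
    ∃ x' : K, x' ≠ 0 ∧ O.valuation x' < 1 ∧
      ∀ a b : ℕ, a < p → b < p → (a ≠ 0 ∨ b ≠ 0) → ∀ z : K, z ≠ 0 →
        O.valuation (x' ^ a * y ^ b) ≠ O.valuation (z ^ p) := by
  rcases O.mem_or_inv_mem x with h | h
  · exact ⟨x, hx, lt_of_le_of_ne ((O.valuation_le_one_iff x).mpr h) (valuation_ne_one_of_pRankTwo hp O hP), hP⟩
  · have hP' := pRankTwo_inv_left O hx hP
    exact ⟨x⁻¹, inv_ne_zero hx, lt_of_le_of_ne ((O.valuation_le_one_iff x⁻¹).mpr h)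
      (valuation_ne_one_of_pRankTwo hp O hP'), hP'⟩

/-- `dim A = 3` from the stub's `dim A ≤ 3` and `dim (locAtCentre A O) = 3` (a localisation does not raise the dimension;
copied from `Lens5_TwistModel.ringKrullDim_eq_three_of_locAtCentre`, with proof). [folklore] -/
theorem ringKrullDim_eq_three_of_locAtCentre {k K : Type} [Field k] [Field K] [Algebra k K] (O : ValuationSubring K)
    (A : Subalgebra k K) (hAO : A.toSubring ≤ O.toSubring)
    (hle : ringKrullDim A ≤ 3) (h3 : ringKrullDim (locAtCentre A.toSubring O) = 3) : ringKrullDim A = 3 := by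
  haveI := isLocalization_locAtCentre hAO
  refine le_antisymm hle ?_
  rw [← h3]
  exact Literature.RingTheory.KrullDimension.ringKrullDim_le_of_isLocalization
    (subringCentre A.toSubring O hAO).primeCompl (locAtCentre A.toSubring O)

/-- **`[K : K^p] = p³`** for the stub's data over a perfect `k` (census ✓ `pDegreeThreeOfPerfect`, proof adapted to the binders
`hdimA`/`hdim3`: tree `finrank_frobenius_eq_pow_of_trdeg_eq` (Matsumura Thm 26.5) with `trdeg_k K = trdeg_k A = dim A = 3`
(`exists_ringKrullDim_eq_and_trdeg_eq`, Thm 5.6)). [cite: Matsumura1987, Thm. 26.5 and Thm. 5.6] -/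
theorem finrank_frobenius_eq_of_stubData (p : ℕ) [Fact p.Prime] {k : Type} [Field k] [CharP k p] [PerfectField k]
    {K : Type} [Field K] [Algebra k K] [CharP K p] (O : ValuationSubring K) (A : Subalgebra k K)
    (hAO : A.toSubring ≤ O.toSubring) (hAfg : A.FG) [IsFractionRing A K] (hdimA : ringKrullDim A ≤ 3)
    (hdim3 : ringKrullDim (locAtCentre A.toSubring O) = 3) :
    Module.finrank (frobenius K p).fieldRange K = p ^ 3 := by
  have hdim := ringKrullDim_eq_three_of_locAtCentre O A hAO hdimA hdim3
  haveI : Algebra.FiniteType k A := A.fg_iff_finiteType.mp hAfg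
  haveI : Algebra.EssFiniteType A K := Algebra.EssFiniteType.of_isLocalization K (nonZeroDivisors A)
  haveI : Algebra.EssFiniteType k K := Algebra.EssFiniteType.comp k A K
  obtain ⟨s, hs, htr⟩ := Literature.RingTheory.KrullDimension.exists_ringKrullDim_eq_and_trdeg_eq k A
  have hs3 : s = 3 := by
    rw [hs] at hdim
    exact_mod_cast hdim
  haveI : FaithfulSMul k A := (faithfulSMul_iff_algebraMap_injective k A).mpr (algebraMap k A).injective
  haveI : FaithfulSMul A K := (faithfulSMul_iff_algebraMap_injective A K).mpr (IsFractionRing.injective A K)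
  haveI : Algebra.IsAlgebraic A K := IsLocalization.isAlgebraic K (nonZeroDivisors A)
  have htrK : Algebra.trdeg k K = (3 : ℕ) := by
    rw [← trdeg_add_eq k A (A := K), trdeg_eq_zero (R := A) (A := K), add_zero, htr, hs3]
  exact Literature.FieldTheory.Separability.finrank_frobenius_eq_pow_of_trdeg_eq p htrK

/-- **PORT 1 (§1 of the memo: graded data).  Size S — PROVED in rev 3 (g10), axioms {propext, Classical.choice, Quot.sound}.**  From `hdefect` the subfield `M = K^p(g₀)` has `p`-th-power values
(✓ `Theorems/…Lens5ImmediateValuesMain.exists_subfield_immediate_values`, verbatim the first four conjuncts); `x, y` of (P2) normalised into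
positive value (`O.mem_or_inv_mem` + census ✓ `pRankTwo_inv_left`; `v x ≠ 1` by (P2) with `(a,b) = (1,0)`, `z = 1`); generators `t` of `A`
(`hAfg`); `[K : M] = p²` (census ✓ `pDegreeThreeOfPerfect` — tree `finrank_frobenius_eq_pow_of_trdeg_eq` with `trdeg_k K = 3` from
`hdimA`/`hdim3`/`hAfg` — + ✓ `…Lens5ImmediateValuesDegree.finrank_over_adjoin_pthPowers_eq`; the two descriptions of `M` agree by
`Subfield.ext` on the membership characterisation); coefficients `cf a ab ∈ M` by ✓ `exists_repr_of_linearIndependent_card_eq` +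
✓ `…Lens5GradedBasis.monomials_linearIndependent`; each graded piece of `a ∈ t ⊆ A ⊆ O` lies in `O` by ✓ `valuation_term_le_sum`. -/
theorem port_gradedData (p : ℕ) [Fact p.Prime] {k : Type} [Field k] [CharP k p] [PerfectField k]
    {K : Type} [Field K] [Algebra k K] (O : ValuationSubring K) (A : Subalgebra k K)
    (hAO : A.toSubring ≤ O.toSubring) (hAfg : A.FG) [IsFractionRing A K] (hdimA : ringKrullDim A ≤ 3)
    (hdim3 : ringKrullDim (locAtCentre A.toSubring O) = 3)
    (g₀ : K) (hg₀ : ∀ c : K, c ^ p ≠ g₀)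
    (hdefect : ∀ f₀ : K, ∃ f₁ : K, O.valuation (g₀ - f₁ ^ p) < O.valuation (g₀ - f₀ ^ p))
    (hP2 : PRankTwoAt p O) :
    ∃ (M : Subfield K), (∀ x : K, x ∈ M ↔ ∃ c : Fin p → K, ∑ j, c j ^ p * g₀ ^ (j : ℕ) = x) ∧ g₀ ∈ M ∧
      (∀ x : K, x ^ p ∈ M) ∧ (∀ m : K, m ∈ M → m ≠ 0 → ∃ w : K, w ≠ 0 ∧ O.valuation m = O.valuation (w ^ p)) ∧
      ∃ (x y : K), x ≠ 0 ∧ y ≠ 0 ∧ O.valuation x < 1 ∧ O.valuation y < 1 ∧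
        (∀ a b : ℕ, a < p → b < p → (a ≠ 0 ∨ b ≠ 0) → ∀ z : K, z ≠ 0 →
          O.valuation (x ^ a * y ^ b) ≠ O.valuation (z ^ p)) ∧
        ∃ (t : Finset K), Algebra.adjoin k (t : Set K) = A ∧
          ∃ (cf : K → Fin p × Fin p → K), (∀ a ∈ t, ∀ ab, cf a ab ∈ M) ∧
            (∀ a ∈ t, ∑ ab : Fin p × Fin p, cf a ab * (x ^ (ab.1 : ℕ) * y ^ (ab.2 : ℕ)) = a) ∧
            (∀ a ∈ t, ∀ ab, cf a ab * (x ^ (ab.1 : ℕ) * y ^ (ab.2 : ℕ)) ∈ O) := by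
  classical
  have hp : p.Prime := Fact.out
  haveI : CharP K p := charP_of_injective_algebraMap (algebraMap k K).injective p
  -- `M = K^p(g₀)` with its `p`-th-power values (✓ ImmediateValues) and `[K : M] = p²` (✓ Degree + the p-degree above)
  obtain ⟨M, hM, hg₀M, hpM, hV⟩ := exists_subfield_immediate_values (p := p) O.valuation g₀ hdefect
  have hdeg := finrank_frobenius_eq_of_stubData p O A hAO hAfg hdimA hdim3
  obtain ⟨M', hM', hfin'⟩ := exists_subfield_pthPowers_adjoin_finrank (p := p) g₀ hg₀ hdeg
  have hMM : M' = M := Subfield.ext fun x => (hM' x).trans (hM x).symm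
  have hfin : Module.finrank M K = p ^ 2 := by subst hMM; exact hfin'
  -- (P2), normalised into the maximal ideal of `O`
  obtain ⟨x₀, y₀, hx₀, hy₀, hP₀⟩ := hP2
  obtain ⟨x, hx, hvx, hPx⟩ := exists_pRankTwo_lt_one_left hp O hx₀ hP₀
  obtain ⟨y, hy, hvy, hPy⟩ := exists_pRankTwo_lt_one_left hp O hy₀ (pRankTwo_swap O hPx)
  have hP := pRankTwo_swap O hPy
  -- generators of `A` and the graded representation over `M` (✓ GradedBasis)
  obtain ⟨t, ht⟩ := hAfg
  have hli := monomials_linearIndependent hp O.valuation M hV hx hy hP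
  have hcard : Fintype.card (Fin p × Fin p) = p ^ 2 := by
    simp [Fintype.card_prod, Fintype.card_fin, pow_two]
  have hrepr : ∀ a : K, ∃ c : Fin p × Fin p → M, ∑ ab, (c ab : K) * (x ^ (ab.1 : ℕ) * y ^ (ab.2 : ℕ)) = a := by
    intro a
    obtain ⟨c, hc⟩ := exists_repr_of_linearIndependent_card_eq M hfin (pow_pos hp.pos 2) _ hli hcard a
    refine ⟨c, ?_⟩
    simpa only [Subfield.smul_def, smul_eq_mul] using hc
  choose c hc using hrepr
  refine ⟨M, hM, hg₀M, hpM, hV, x, y, hx, hy, hvx, hvy, hP, t, ht, fun a ab => (c a ab : K),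
    fun a _ ab => (c a ab).2, fun a _ => hc a, ?_⟩
  intro a ha ab
  have haA : a ∈ A := by
    rw [← ht]
    exact Algebra.subset_adjoin (Finset.mem_coe.mpr ha)
  have haO : a ∈ O := show a ∈ O.toSubring from hAO haA
  have hva : O.valuation a ≤ 1 := (O.valuation_le_one_iff a).mpr haO
  have hterm := valuation_term_le_sum hp O.valuation M hV hx hy hP (fun ab => (c a ab : K)) (fun ab => (c a ab).2) ab
  rw [hc a] at hterm
  exact (O.valuation_le_one_iff _).mp (hterm.trans hva)


end PortOne

/-! ## §2 Kernel-checked helpers (no sorry) -/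

section Helpers

variable {K : Type} [Field K]

/-- **(PB0)** (census `exponents_eq_zero_of_valuation_eq_one`, verbatim with proof).  Under (P2) for `x, y`: if `ν · (x^a y^b)`
(`a, b < p`) has value zero and `ν` has the value of a `p`-th power `z^p` (`z ≠ 0`), then `a = b = 0`. [folklore] -/
theorem exponents_eq_zero_of_valuation_eq_one {p : ℕ} (O : ValuationSubring K) {x y : K}
    (hP : ∀ a b : ℕ, a < p → b < p → (a ≠ 0 ∨ b ≠ 0) → ∀ z : K, z ≠ 0 → O.valuation (x ^ a * y ^ b) ≠ O.valuation (z ^ p))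
    {a b : ℕ} (ha : a < p) (hb : b < p) {ν z : K} (hz : z ≠ 0) (hν : O.valuation ν = O.valuation (z ^ p))
    (hval : O.valuation (ν * (x ^ a * y ^ b)) = 1) : a = 0 ∧ b = 0 := by
  by_contra hab
  have hab' : a ≠ 0 ∨ b ≠ 0 := by
    by_cases h : a = 0
    · exact Or.inr fun hb0 => hab ⟨h, hb0⟩
    · exact Or.inl h
  rw [map_mul] at hval
  have hmono : O.valuation (x ^ a * y ^ b) = (O.valuation ν)⁻¹ := eq_inv_of_mul_eq_one_right hval
  have hzinv : z⁻¹ ≠ 0 := inv_ne_zero hz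
  apply hP a b ha hb hab' z⁻¹ hzinv
  rw [hmono, hν, inv_pow, map_inv₀]

/-- Integer powers of a «unit of `T = locAtCentre B O`» (an element of value `1`) stay in `T`. [folklore] -/
theorem zpow_mem_locAtCentre {B : Subring K} {O : ValuationSubring K} {a : K}
    (ha : a ∈ locAtCentre B O) (hv : O.valuation a = 1) (n : ℤ) : a ^ n ∈ locAtCentre B O := by
  obtain ⟨m, rfl | rfl⟩ := Int.eq_nat_or_neg n
  · rw [zpow_natCast]; exact pow_mem ha m
  · rw [zpow_neg, zpow_natCast, ← inv_pow]; exact pow_mem (inv_mem_locAtCentre ha hv) m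

/-- A Laurent monomial in elements with `p`-th-power values has a `p`-th-power value. [folklore] -/
theorem exists_valuation_prod_zpow_eq (O : ValuationSubring K) {p : ℕ} (z : Fin 3 → K)
    (hzV : ∀ i, ∃ w : K, w ≠ 0 ∧ O.valuation (z i) = O.valuation (w ^ p)) (c : Fin 3 → ℤ) :
    ∃ W : K, W ≠ 0 ∧ O.valuation (∏ i, z i ^ c i) = O.valuation (W ^ p) := by
  choose w hw0 hw using hzV
  refine ⟨∏ i, w i ^ c i, Finset.prod_ne_zero_iff.mpr fun i _ => zpow_ne_zero _ (hw0 i), ?_⟩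
  rw [map_prod, ← Finset.prod_pow, map_prod]
  refine Finset.prod_congr rfl fun i _ => ?_
  rw [map_zpow₀, hw, map_pow, map_pow, map_zpow₀, ← zpow_natCast, ← zpow_mul,
    ← zpow_natCast (O.valuation (w i) ^ c i), ← zpow_mul, mul_comm]

end Helpers

end Summit.ResolutionOfSingularities.ResolutionOfSingularities.Theorems.RadicialJung.CleanModels.Lens5.PRankTwoAssembly

end
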